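import Literature.MathematicalPhysics.QuantumFieldTheory.Balaban1983to89.T4BetaFlowWellPosed

/-!
# EriceRemainderEnclosureHistoryAutonomySharp — (E37d) THE ZEROTH-MOMENT SMALLNESS IS LOAD-BEARING FOR THE INTRINSIC CHARACTERISATION,
# AT THE LATTICE LEVEL: one Markov history family — node U2's bump functional made stationary, `β_{k+1}(g_0,…,g_k) = 2 + tent(g_k)` —
# carries TWO admissible families of pinned runs (every binder of node U2's `T4BetaFlowWellPosed.gstar_eq_gstar_of_betaInf_agree` and of
# (E37c) `gstar_eq_gstar_of_betaInf_agree_rows` ∕ `_sign` EXCEPT the smallness: `InjectedRate 0 0 θ`, `ScaleShiftRate 0 θ 1`,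
# `HistLipschitz` with rows `20` and `FadingMemory 20 θs` for every `θs`, sign, floor `2`, box ]0,1], pin `1`) with the SAME β — hence the
# same limit functional — and DIFFERENT continuum running couplings (`hSlow ≠ hFast`): without `M·γ < b` the continuum running coupling is
# NOT a function of `(betaInf β, g_IR)` over the class

Cell `pub-balaban`, β-function sub-cell, BINDER row D4 «RemainderConst leaves for Bałaban's split» (`HOME/BINDER-OWNERS.md`; owner
lineage `b2b-balaban-beta-an4`; this file by co-owner #2 lineage `b2b-balaban-beta-d4-p2`, generation 39), β-FLOW TEAM duty (1),
FREEZE (0) honoured (def-free: the witness family is node U2's `T4BetaStationary.ofFunctional bumpB 1` and its runs are node U2's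
`T4BetaFlowWellPosed.Sharpness.hSlow` ∕ `hFast` read backwards from the pin — `memFlow_hSlow`, `memFlow_hFast`, `hSlow_ne_hFast`,
`seqBox_hSlow`, `seqBox_hFast`, `le_bumpB`, `abs_tent_sub_tent_le` BY NAME; nothing restated).  Companion of (E37a)∕(E37b)∕(E37c)
`EriceRemainderEnclosureHistoryAutonomy{,WellPosed,End}`; independent of them (imports node U2's `T4BetaFlowWellPosed` only).

HONEST FRAMING (page 1, verbatim and binding).  *"Discharging BetaPertH makes Bałaban's UV stability UNCONDITIONAL — a real
constructive-QFT result; it is NOT the continuum limit and NOT the Clay problem."*  THIS FILE DISCHARGES NOTHING OF THE KIND.  A kernel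
WITNESS about hypothesis SHAPES (node U2's `InjectedRate` ∕ `ScaleShiftRate` ∕ `HistLipschitz` ∕ `FadingMemory`, the floor, the box —
NOT PRINTED, GAPS G-t4-U2-1∕-2), saying which binder of a kernel theorem cannot be dropped; the witness is a toy Markov family, NOT
Bałaban's (1.22), about which nothing is asserted.  Row D4 class UNCHANGED (critical-path width 0; instance 0∕1; D4 DISCHARGE NO DATE).
HONEST DEPENDENCY: continuum YM on T⁴ ⇐ BetaPertH ∧ nine spine estimates (0/9 proved); BetaPertH ⇐ (D1) ∧ (D4) ∧ CAP+tail; G-an2-4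
gates asym, D1 and NE2/3/4.

THE POINT (census sense (α); the AUTONOMY row — sharpness in KIND of its second half).  (E37a): the identification
`MemFlow (betaInf β) g_IR (gstar g)` is FREE (no memory hypothesis).  (E37b)∕(E37c): under the zeroth moment with `M·γ < b` the memory
flow DETERMINES the trajectory, so the continuum running coupling depends on the β-family only through `betaInf β`.  Node U2's
`Sharpness.exists_memFlow_ne_memFlow` shows the abstract flow of `bumpB` has two box solutions from `g_IR = 1` (`M·γ∕b = 10`).  THIS FILE
lifts that to the LATTICE: §1 every box solution `h` of the flow of a MARKOV functional (`B u` depends on `u 0` only) generates the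
STATIONARY family of runs `K ↦ (k ↦ h (K − k))` of `ofFunctional B p` — exact runs for every cutoff, pinned at `h 0`, consecutive cutoffs
agreeing EXACTLY at infrared-matched scales (`disc ≡ 0`, so `InjectedRate 0 0 θ` for every θ), `ScaleShiftRate 0 θ γ`, and continuum
running coupling `gstar = h`; §2 for `bumpB` on ]0,1]: `HistLipschitz (20·θs^{k−i}) 1` with `FadingMemory 20 θs` for every `θs ∈ [0,1[`
(node U2's `histLipschitz_ofFunctional` ∕ `fadingMemory_geom`), rows `= 20` at `θs = 0`, floor and sign `2 ≤ β`; §3 the two families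
from `hSlow` and `hFast`: SAME β, SAME pin `1`, `gstar gS = hSlow ≠ hFast = gstar gF` — so node U2's `gstar_eq_gstar_of_betaInf_agree` with
`hsmall : Cm·γ < b(1−θs)` DELETED (all other binders kept, universally closed) is FALSE, and likewise (E37c)'s `_rows` form with `M·γ < b`
deleted and `_sign` form with (E33)'s smallness deleted (`existsUnique_memFlow_betaInf_*` too: two box solutions).  For the witness
`M·γ∕b = 20·1∕2 = 10` ((E33)'s `M·(γ³ + 2γ∕b) = 40`).  DEGREE (the true constant in `M·γ∕b < τ`) is NOT decided here (node U2's §9 decides the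
floor-FREE analogue: first moment, degree 2).

WHAT IS PROVED ([folklore]; 0 `def`, 0 sorry).
 §1 Markov stationary embedding: `rgEqH_stationary_of_memFlow`, `box_stationary`, `pin_stationary`, `disc_stationary_eq_zero`,
    `injectedRate_stationary`, `scaleShiftRate_ofFunctional_markov`, `invSq_stationary`, `astar_stationary`, **`gstar_stationary`**.
 §2 The bump family: `bump_markov`, `histLipschitz_bump`, `fadingMemory_bump`, `rows_bump` (`= 20` at θs = 0), `betaLowerH_bump`,
    `eventualLowerH_bump`.
 §3 **`two_families_same_betaInf`**, **`gstar_not_determined_by_betaInf_without_smallness`** (node U2's binder list minus `hsmall`,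
    universally closed, is false), **`not_existsUnique_memFlow_betaInf_bump`**.
-/

noncomputable section
open Filter Topology Finset

namespace Summit.QuantumFields.BalabanUV.Beta.EriceRemainderEnclosureHistoryAutonomySharp

open Literature.MathematicalPhysics.QuantumFieldTheory.Balaban1983to89
open Literature.MathematicalPhysics.QuantumFieldTheory.Balaban1983to89.FlowStep
open Literature.MathematicalPhysics.QuantumFieldTheory.Balaban1983to89.T4CouplingMatching
open Literature.MathematicalPhysics.QuantumFieldTheory.Balaban1983to89.T4CauchySum (InjectedRate)
open Literature.MathematicalPhysics.QuantumFieldTheory.Balaban1983to89.T4ContinuumCoupling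
open Literature.MathematicalPhysics.QuantumFieldTheory.Balaban1983to89.T4BetaStationary
open Literature.MathematicalPhysics.QuantumFieldTheory.Balaban1983to89.T4BetaFlowWellPosed
open Literature.MathematicalPhysics.QuantumFieldTheory.Balaban1983to89.T4BetaFlowWellPosed.Sharpness

/-! ## §1 A box solution of a MARKOV memory flow generates a stationary family of exact runs with `gstar = h` -/

variable {B : (ℕ → ℝ) → ℝ} {γ gIR p θ : ℝ} {h : ℕ → ℝ}

/-- **STATIONARY EMBEDDING**: if `B u` depends on `u 0` only and `h` solves `MemFlow B gIR`, then for every cutoff `K` the reversed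
trajectory `k ↦ h (K − k)` is an EXACT run of (0.20) for the stationary family `ofFunctional B p` (any padding `p`):
`RGEqH K (ofFunctional B p) (fun k ↦ h (K − k))`. [folklore] -/
theorem rgEqH_stationary_of_memFlow (hB0 : ∀ u u' : ℕ → ℝ, u 0 = u' 0 → B u = B u') (hf : MemFlow B gIR h) (K : ℕ) :
    RGEqH K (ofFunctional B p) (fun k => h (K - k)) := by
  intro k hk
  dsimp only
  obtain ⟨m, hm⟩ : ∃ m, K - (k + 1) = m := ⟨_, rfl⟩
  have e1 : K - k = m + 1 := by omega
  rw [ofFunctional_apply, e1, hm, hf.2 m]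
  congr 1
  refine hB0 _ _ ?_
  rw [padHist_of_le p _ (Nat.zero_le k), prefixOf_apply]
  show h (m + 1 + 0) = h (K - (k - 0 : ℕ))
  rw [Nat.sub_zero, e1, Nat.add_zero]

/-- The stationary family lies in the box of `h`. [folklore] -/
theorem box_stationary (hh : SeqBox γ h) : ∀ K i, i ≤ K → 0 < h (K - i) ∧ h (K - i) ≤ γ :=
  fun K i _ => hh (K - i)

/-- … and is pinned at `h 0 = gIR`. [folklore] -/
theorem pin_stationary (hf : MemFlow B gIR h) : ∀ K, (fun k => h (K - k)) K = gIR := fun K => by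
  simp [hf.1]

/-- CONSECUTIVE CUTOFFS AGREE EXACTLY at infrared-matched scales: `disc (run K) (run (K+1)) j = 0`. [folklore] -/
theorem disc_stationary_eq_zero (h : ℕ → ℝ) (K j : ℕ) :
    disc (fun k => h (K - k)) (fun k => h (K + 1 - k)) j = 0 := by
  simp [disc, Nat.add_sub_add_right]

/-- … hence node U2's output shape holds with constant ZERO: `InjectedRate 0 0 θ`, for every `θ`. [folklore] -/
theorem injectedRate_stationary (h : ℕ → ℝ) (θ : ℝ) :
    InjectedRate 0 0 θ (fun K j => disc (fun k => h (K - k)) (fun k => h (K + 1 - k)) j) := by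
  intro K j _
  dsimp only
  rw [disc_stationary_eq_zero]
  simp

/-- A stationary MARKOV family has scale-shift rate ZERO: `ScaleShiftRate 0 θ γ (ofFunctional B p)` (dropping the bare coupling does not
change age `0`). [folklore] -/
theorem scaleShiftRate_ofFunctional_markov (hB0 : ∀ u u' : ℕ → ℝ, u 0 = u' 0 → B u = B u') (θ γ p : ℝ) :
    ScaleShiftRate 0 θ γ (ofFunctional B p) := by
  intro k w _
  rw [ofFunctional_apply, ofFunctional_apply, hB0 _ _ (padHist_tail_of_le p w (Nat.zero_le k)).symm, sub_self, abs_zero,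
    zero_mul]

/-- The recursion variables of the stationary family at physical scale `m` do not depend on the cutoff: `invSq = 1∕(h m)²`. [folklore] -/
theorem invSq_stationary (h : ℕ → ℝ) (m n : ℕ) : invSq (fun K k => h (K - k)) m n = 1 / (h m) ^ 2 := by
  simp [invSq]

/-- … so `astar = 1∕(h m)²` … [folklore] -/
theorem astar_stationary (h : ℕ → ℝ) (m : ℕ) : astar (fun K k => h (K - k)) m = 1 / (h m) ^ 2 := by
  unfold astar
  have : invSq (fun K k => h (K - k)) m = fun _ => 1 / (h m) ^ 2 := funext fun n => invSq_stationary h m n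
  rw [this]
  exact tendsto_const_nhds.limUnder_eq

/-- … and **THE CONTINUUM RUNNING COUPLING OF THE STATIONARY FAMILY IS `h` ITSELF**: `gstar (fun K k ↦ h (K − k)) = h` (for positive `h`).
[folklore] -/
theorem gstar_stationary (hpos : ∀ m, 0 < h m) : gstar (fun K k => h (K - k)) = h := by
  funext m
  rw [gstar, astar_stationary]
  exact one_div_sqrt_one_div_sq (hpos m)

/-! ## §2 Node U2's bump functional as a stationary history family on ]0,1] -/

/-- `bumpB u = 2 + tent (u 0)` reads age `0` only. [folklore] -/
theorem bump_markov : ∀ u u' : ℕ → ℝ, u 0 = u' 0 → bumpB u = bumpB u' := fun u u' e => by simp [bumpB, e]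

/-- HISTORY MODULUS of the bump family: `HistLipschitz (20·θs^{k−i}) 1 (ofFunctional bumpB 1)` for every `θs ∈ [0,1[` (node U2's
`histLipschitz_ofFunctional` + `memoryProfile_bumpB`). [folklore] -/
theorem histLipschitz_bump {θs : ℝ} (hθs0 : 0 ≤ θs) (hθs1 : θs < 1) :
    HistLipschitz (fun k i => 20 * θs ^ (k - i)) 1 (ofFunctional bumpB 1) :=
  histLipschitz_ofFunctional (memoryProfile_bumpB hθs0 hθs1) one_pos le_rfl

/-- … with `FadingMemory 20 θs`. [folklore] -/
theorem fadingMemory_bump {θs : ℝ} (hθs0 : 0 ≤ θs) : FadingMemory 20 θs (fun k i => 20 * θs ^ (k - i)) :=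
  fadingMemory_geom (by norm_num) hθs0

/-- ROWS of the modulus at `θs = 0` (the sharp Markov modulus `20·[i = k]`): `Σ_{i≤k} 20·0^{k−i} = 20`, nonnegative entries. [folklore] -/
theorem rows_bump (k : ℕ) :
    (∀ i, i ≤ k → (0 : ℝ) ≤ 20 * (0 : ℝ) ^ (k - i)) ∧ ∑ i ∈ range (k + 1), (20 : ℝ) * (0 : ℝ) ^ (k - i) ≤ 20 := by
  refine ⟨fun i _ => by positivity, le_of_eq ?_⟩
  rw [Finset.sum_eq_single k]
  · simp
  · intro i hi hik
    have : k - i ≠ 0 := by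
      have := mem_range.mp hi
      omega
    simp [zero_pow this]
  · intro hk; exact absurd (mem_range.mpr (Nat.lt_succ_self k)) hk

/-- SIGN AND FLOOR: `2 ≤ β_{k+1}` on every box (node U2's `le_bumpB`). [folklore] -/
theorem betaLowerH_bump (γ : ℝ) : BetaLowerH 2 γ (ofFunctional bumpB 1) := fun k v _ => by
  rw [ofFunctional_apply]; exact le_bumpB _

/-- … hence `BetaLowerH 0` and `EventualLowerH 2 γ 0`. [folklore] -/
theorem eventualLowerH_bump (γ : ℝ) : BetaLowerH 0 γ (ofFunctional bumpB 1) ∧ EventualLowerH 2 γ 0 (ofFunctional bumpB 1) :=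
  ⟨fun k v hv => (by norm_num : (0 : ℝ) ≤ 2).trans (betaLowerH_bump γ k v hv),
    eventualLowerH_of_betaLowerH (betaLowerH_bump γ) 0⟩

/-! ## §3 Two admissible lattice families, one β, one pin, two continuum running couplings -/

/-- **THE WITNESS.**  For the ONE history family `β = ofFunctional bumpB 1` the two stationary families `gS K k = hSlow (K − k)`,
`gF K k = hFast (K − k)` are runs of (0.20) for every cutoff, in ]0,1], pinned at `1`, with node U2's output shape `InjectedRate 0 0 θ` (every
θ), `ScaleShiftRate 0 θ 1 β` (every θ), `HistLipschitz (20·θs^{k−i}) 1 β` ∧ `FadingMemory 20 θs` (every `θs ∈ [0,1[`), rows `≤ 20` at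
`θs = 0`, sign, floor `2` — and `gstar gS = hSlow ≠ hFast = gstar gF` although the limit functional is the same (`betaInf β`, literally).
[folklore] -/
theorem two_families_same_betaInf :
    (∀ K, RGEqH K (ofFunctional bumpB 1) (fun k => hSlow (K - k))) ∧
    (∀ K, RGEqH K (ofFunctional bumpB 1) (fun k => hFast (K - k))) ∧
    (∀ K i, i ≤ K → 0 < hSlow (K - i) ∧ hSlow (K - i) ≤ 1) ∧ (∀ K i, i ≤ K → 0 < hFast (K - i) ∧ hFast (K - i) ≤ 1) ∧
    (∀ K, (fun k => hSlow (K - k)) K = 1) ∧ (∀ K, (fun k => hFast (K - k)) K = 1) ∧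
    (∀ θ, InjectedRate 0 0 θ (fun K j => disc (fun k => hSlow (K - k)) (fun k => hSlow (K + 1 - k)) j)) ∧
    (∀ θ, InjectedRate 0 0 θ (fun K j => disc (fun k => hFast (K - k)) (fun k => hFast (K + 1 - k)) j)) ∧
    (∀ θ, ScaleShiftRate 0 θ 1 (ofFunctional bumpB 1)) ∧
    (∀ θs, 0 ≤ θs → θs < 1 → HistLipschitz (fun k i => 20 * θs ^ (k - i)) 1 (ofFunctional bumpB 1) ∧
      FadingMemory 20 θs (fun k i => 20 * θs ^ (k - i))) ∧
    BetaLowerH 0 1 (ofFunctional bumpB 1) ∧ EventualLowerH 2 1 0 (ofFunctional bumpB 1) ∧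
    gstar (fun K k => hSlow (K - k)) = hSlow ∧ gstar (fun K k => hFast (K - k)) = hFast ∧ hSlow ≠ hFast :=
  ⟨rgEqH_stationary_of_memFlow bump_markov memFlow_hSlow, rgEqH_stationary_of_memFlow bump_markov memFlow_hFast,
    box_stationary seqBox_hSlow, box_stationary seqBox_hFast, pin_stationary memFlow_hSlow, pin_stationary memFlow_hFast,
    injectedRate_stationary hSlow, injectedRate_stationary hFast, fun θ => scaleShiftRate_ofFunctional_markov bump_markov θ 1 1,
    fun _ h0 h1 => ⟨histLipschitz_bump h0 h1, fadingMemory_bump h0⟩, (eventualLowerH_bump 1).1, (eventualLowerH_bump 1).2,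
    gstar_stationary fun m => (seqBox_hSlow m).1, gstar_stationary fun m => (seqBox_hFast m).1, hSlow_ne_hFast⟩

/-- **THE SMALLNESS CANNOT BE DROPPED FROM THE INTRINSIC CHARACTERISATION.**  The statement «two families of pinned runs in the box with
node U2's output shapes, ONE history family with `ScaleShiftRate`, `HistLipschitz Λ` (`Λ ≥ 0`, rows `≤ M`, `FadingMemory Cm θs Λ`), the floor
`EventualLowerH b` (`b > 0`), the SAME pin ⟹ the same continuum running coupling» — i.e. node U2's `gstar_eq_gstar_of_betaInf_agree` ∕
(E37c)'s `gstar_eq_gstar_of_betaInf_agree_rows` for `βt = β` with the smallness (`Cm·γ < b(1−θs)` ∕ `M·γ < b`) DELETED and everything else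
kept — is FALSE. [folklore] -/
theorem gstar_not_determined_by_betaInf_without_smallness :
    ¬ (∀ (β : HBeta) (g gt : ℕ → ℕ → ℝ) (γ gIR C θ₁ c θs Cm M b : ℝ) (Λ : ℕ → ℕ → ℝ) (k₀ : ℕ),
        θ₁ < 1 → InjectedRate C 0 θ₁ (fun K j => disc (g K) (g (K + 1)) j) →
        InjectedRate C 0 θ₁ (fun K j => disc (gt K) (gt (K + 1)) j) →
        (∀ K i, i ≤ K → 0 < g K i ∧ g K i ≤ γ) → (∀ K i, i ≤ K → 0 < gt K i ∧ gt K i ≤ γ) →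
        (∀ K, RGEqH K β (g K)) → (∀ K, RGEqH K β (gt K)) → (∀ K, g K K = gIR) → (∀ K, gt K K = gIR) →
        ScaleShiftRate c θs γ β → HistLipschitz Λ γ β → (∀ k i, i ≤ k → 0 ≤ Λ k i) →
        (∀ k, ∑ i ∈ range (k + 1), Λ k i ≤ M) → FadingMemory Cm θs Λ → 0 ≤ θs → θs < 1 →
        EventualLowerH b γ k₀ β → 0 < b → gstar g = gstar gt) := by
  intro H
  obtain ⟨hrS, hrF, hbS, hbF, hpS, hpF, hiS, hiF, hss, hLF, -, hev, hgS, hgF, hne⟩ := two_families_same_betaInf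
  have h := H (ofFunctional bumpB 1) (fun K k => hSlow (K - k)) (fun K k => hFast (K - k)) 1 1 0 0 0 0 20 20 2
    (fun k i => 20 * (0 : ℝ) ^ (k - i)) 0 zero_lt_one (hiS 0) (hiF 0) hbS hbF hrS hrF hpS hpF (hss 0) (hLF 0 le_rfl zero_lt_one).1
    (fun k i hi => (rows_bump k).1 i hi) (fun k => (rows_bump k).2) (hLF 0 le_rfl zero_lt_one).2 le_rfl zero_lt_one hev two_pos
  exact hne (hgS.symm.trans (h.trans hgF))

/-- **`∃!` FAILS TOO**: the `betaInf (ofFunctional bumpB 1)`-flow from the pin `1` has two distinct box solutions on ]0,1] — the continuum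
running couplings of the two admissible families (so (E37c)'s `existsUnique_memFlow_betaInf_rows` ∕ `_sign` minus the smallness is false;
`M·γ∕b = 10` here). [folklore] -/
theorem not_existsUnique_memFlow_betaInf_bump :
    ¬ ∃! u : ℕ → ℝ, SeqBox 1 u ∧ MemFlow (betaInf (ofFunctional bumpB 1)) 1 u := by
  -- the limit functional of the stationary Markov family IS `bumpB` on the box (representation with rate 0)
  have hrep : ∀ u, SeqBox 1 u → betaInf (ofFunctional bumpB 1) u = bumpB u := by
    intro u hu
    have ht := tendsto_betaInf (scaleShiftRate_ofFunctional_markov bump_markov (1 / 2 : ℝ) 1 1) (by norm_num) hu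
    have hc : (fun k => ofFunctional bumpB 1 k (revHist u k)) = fun _ => bumpB u := by
      funext k
      rw [ofFunctional_apply]
      exact bump_markov _ _ (by rw [padHist_of_le 1 _ (Nat.zero_le k), revHist_apply]; simp)
    rw [hc] at ht
    exact tendsto_nhds_unique ht tendsto_const_nhds
  have hflow : ∀ u, SeqBox 1 u → MemFlow bumpB 1 u → MemFlow (betaInf (ofFunctional bumpB 1)) 1 u := by
    intro u hu hf
    refine ⟨hf.1, fun m => ?_⟩
    rw [hrep _ (seqBox_shift hu (m + 1)), hf.2 m]
  rintro ⟨u, -, huniq⟩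
  have h1 := huniq hSlow ⟨seqBox_hSlow, hflow _ seqBox_hSlow memFlow_hSlow⟩
  have h2 := huniq hFast ⟨seqBox_hFast, hflow _ seqBox_hFast memFlow_hFast⟩
  exact hSlow_ne_hFast (h1.trans h2.symm)

end Summit.QuantumFields.BalabanUV.Beta.EriceRemainderEnclosureHistoryAutonomySharp

end
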